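import Mathlib.Analysis.InnerProductSpace.PiL2
import Mathlib.Data.List.GetD
import Mathlib.Topology.Order.IntermediateValue

/-!
# Spherical codes with an exact Gram matrix over a real algebraic number field of ANY degree (kernel checker)

Framing: lottery ticket; floor = certified bounds/negative ranges. Venture `PackingBounds` (cell `pub-packcert`, seat
`pub-packcert-recog`, RECOG.md v35 §26 ALG-GRAM) — attained-side infrastructure generalising `WeightedListConfig.lean`
(which needs a computable ring `R ↪ ℝ`, available only for `ℤ[√d]`) to number fields of any degree WITHOUT field
arithmetic in the kernel: a field element is an INTEGER polynomial (coefficient list, low → high) evaluated at a real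
root `α` of an integer polynomial `P`; `α ∈ [a/D, b/D]` exists by the intermediate value theorem from the integer sign
test `fieldOK`; a row is a unit vector because `c · (Σ_k W_k l_k l_k − q) − u · P ≡ 0` for supplied `c ≠ 0`, `u`
(`normOK`); two rows have `⟪·,·⟫ ≤ s(α) = Snum(α)/sden` because the integer interval-Horner LOWER bound of
`c · (q · Snum − sden · Σ_k W_k l_k l'_k) − u · P` on `[a/D, b/D]` is `≥ 0` for supplied `c > 0`, `u` (`pairOK`; a pair
AT the bound carries its exact quotient and the polynomial vanishes identically); weights `W_k(α) ≥ 0` and `s(α) < 1`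
likewise (`weightsOK`, `boundOK`). Points are `((√q)⁻¹ · l_k(α) · √(W_k(α)))_k ∈ ℝⁿ`, so `⟪x_l, x_l'⟫ = (Σ W l l')(α)/q`.
All checks are Boolean programs over `ℤ` (`decide`); conclusion `exists_code_alg`. `Snum = [t], sden = e` gives the
rational bound `t/e`; `Snum = [0, 1], sden = 1` gives the bound `α` itself (a code at its own algebraic angle).
-/

namespace Summit.Ventures.PackingBounds.Config.AlgWeighted

open Finset WithLp Set
/-- Evaluation of a coefficient list at a real point (Horner form). -/
noncomputable def leval (x : ℝ) : List ℤ → ℝ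
  | [] => 0
  | a :: t => (a : ℝ) + x * leval x t

/-- Sum of coefficient lists. -/
def ladd : List ℤ → List ℤ → List ℤ
  | [], g => g
  | a :: f, [] => a :: f
  | a :: f, b :: g => (a + b) :: ladd f g

/-- Scalar multiple of a coefficient list. -/
def lsmul (c : ℤ) : List ℤ → List ℤ
  | [] => []
  | a :: f => (c * a) :: lsmul c f

/-- Product of coefficient lists. -/
def lmul : List ℤ → List ℤ → List ℤ
  | [], _ => []
  | a :: f, g => ladd (lsmul a g) (0 :: lmul f g)

/-- Difference of coefficient lists. -/
def lsub (f g : List ℤ) : List ℤ := ladd f (lsmul (-1) g)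

/-- All coefficients vanish. -/
def lzero (f : List ℤ) : Bool := f.all fun a => a == 0

/-- `leval` on `[]`. -/
@[simp] theorem leval_nil (x : ℝ) : leval x [] = 0 := rfl
/-- `leval` on a cons cell. -/
@[simp] theorem leval_cons (x : ℝ) (a : ℤ) (t : List ℤ) : leval x (a :: t) = a + x * leval x t := rfl

/-- `leval` is additive. -/
theorem leval_ladd (x : ℝ) (f g : List ℤ) : leval x (ladd f g) = leval x f + leval x g := by
  induction f generalizing g with
  | nil => simp [ladd]
  | cons a f ih =>
    cases g with
    | nil => simp [ladd]
    | cons b g => simp only [ladd, leval_cons, ih, Int.cast_add]; ring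

/-- `leval` commutes with scalars. -/
theorem leval_lsmul (x : ℝ) (c : ℤ) (f : List ℤ) : leval x (lsmul c f) = c * leval x f := by
  induction f with
  | nil => simp [lsmul]
  | cons a f ih => simp only [lsmul, leval_cons, ih, Int.cast_mul]; ring

/-- `leval` is multiplicative. -/
theorem leval_lmul (x : ℝ) (f g : List ℤ) : leval x (lmul f g) = leval x f * leval x g := by
  induction f with
  | nil => simp [lmul]
  | cons a f ih => simp only [lmul, leval_ladd, leval_lsmul, leval_cons, ih, Int.cast_zero]; ring

/-- `leval` of a difference. -/
theorem leval_lsub (x : ℝ) (f g : List ℤ) : leval x (lsub f g) = leval x f - leval x g := by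
  simp only [lsub, leval_ladd, leval_lsmul, Int.cast_neg, Int.cast_one]; ring

/-- The zero list evaluates to `0`. -/
theorem leval_of_lzero (x : ℝ) {f : List ℤ} (h : lzero f = true) : leval x f = 0 := by
  induction f with
  | nil => rfl
  | cons a f ih =>
    simp only [lzero, List.all_cons, Bool.and_eq_true, beq_iff_eq] at h
    simp only [leval_cons, h.1, Int.cast_zero, zero_add, ih (by simpa [lzero] using h.2), mul_zero]

/-- `leval` is continuous in the point. -/
theorem continuous_leval (f : List ℤ) : Continuous fun x : ℝ => leval x f := by
  induction f with
  | nil => exact continuous_const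
  | cons a f ih =>
    show Continuous fun x : ℝ => (a : ℝ) + x * leval x f
    exact continuous_const.add (continuous_id.mul ih)

/-- Scaled interval Horner enclosure: `(L, H)` with `L ≤ D^{length f} · f(x) ≤ H` whenever `a ≤ D x ≤ b`. -/
def ihz (a b : ℤ) (D : ℕ) : List ℤ → ℤ × ℤ
  | [] => (0, 0)
  | c :: t =>
    (c * (D : ℤ) ^ (t.length + 1) +
        min (min ((ihz a b D t).1 * a) ((ihz a b D t).1 * b)) (min ((ihz a b D t).2 * a) ((ihz a b D t).2 * b)),
      c * (D : ℤ) ^ (t.length + 1) +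
        max (max ((ihz a b D t).1 * a) ((ihz a b D t).1 * b)) (max ((ihz a b D t).2 * a) ((ihz a b D t).2 * b)))

/-- A linear function on an interval lies between its values at the end points. -/
theorem corner_lin (c t a b : ℝ) (ha : a ≤ t) (hb : t ≤ b) :
    min (c * a) (c * b) ≤ c * t ∧ c * t ≤ max (c * a) (c * b) := by
  rcases le_total 0 c with hc | hc
  · exact ⟨(min_le_left _ _).trans (by nlinarith), le_trans (by nlinarith) (le_max_right _ _)⟩
  · exact ⟨(min_le_right _ _).trans (by nlinarith), le_trans (by nlinarith) (le_max_left _ _)⟩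

/-- Bilinear corner bounds for `X · Y` with `Y ∈ [L, H]`, `X ∈ [a, b]`. -/
theorem corner_bil (L H Y a b X : ℝ) (hL : L ≤ Y) (hH : Y ≤ H) (ha : a ≤ X) (hb : X ≤ b) :
    min (min (L * a) (L * b)) (min (H * a) (H * b)) ≤ X * Y ∧
      X * Y ≤ max (max (L * a) (L * b)) (max (H * a) (H * b)) := by
  have h1 := corner_lin X Y L H hL hH
  have h2 := corner_lin L X a b ha hb
  have h3 := corner_lin H X a b ha hb
  rw [mul_comm X L, mul_comm X H] at h1
  exact ⟨(min_le_min h2.1 h3.1).trans h1.1, h1.2.trans (max_le_max h2.2 h3.2)⟩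

/-- Soundness of the scaled interval Horner enclosure. -/
theorem ihz_sound (a b : ℤ) (D : ℕ) (x : ℝ) (ha : (a : ℝ) ≤ D * x) (hb : (D : ℝ) * x ≤ b) (f : List ℤ) :
    ((ihz a b D f).1 : ℝ) ≤ (D : ℝ) ^ f.length * leval x f ∧
      (D : ℝ) ^ f.length * leval x f ≤ ((ihz a b D f).2 : ℝ) := by
  induction f with
  | nil => simp [ihz]
  | cons c t ih =>
    obtain ⟨ihL, ihH⟩ := ih
    have key : (D : ℝ) ^ (c :: t).length * leval x (c :: t) =
        c * (D : ℝ) ^ (t.length + 1) + (D * x) * ((D : ℝ) ^ t.length * leval x t) := by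
      simp only [List.length_cons, leval_cons]; ring
    have hc := corner_bil _ _ _ _ _ _ ihL ihH ha hb
    rw [key]
    simp only [ihz]
    push_cast
    exact ⟨by linarith [hc.1], by linarith [hc.2]⟩

/-- Interval lower bound `≥ 0` gives `f(x) ≥ 0` on the interval. -/
theorem leval_nonneg_of_ihz (a b : ℤ) (D : ℕ) (hD : 0 < D) (x : ℝ) (ha : (a : ℝ) ≤ D * x)
    (hb : (D : ℝ) * x ≤ b) (f : List ℤ) (h : 0 ≤ (ihz a b D f).1) : 0 ≤ leval x f := by
  have hDr : (0 : ℝ) < D := by exact_mod_cast hD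
  have h1 := (ihz_sound a b D x ha hb f).1
  have hh : (0 : ℝ) ≤ ((ihz a b D f).1 : ℝ) := by exact_mod_cast h
  by_contra hc
  push Not at hc
  have : (D : ℝ) ^ f.length * leval x f < 0 := mul_neg_of_pos_of_neg (by positivity) hc
  linarith

/-- Interval lower bound `> 0` gives `f(x) > 0` on the interval. -/
theorem leval_pos_of_ihz (a b : ℤ) (D : ℕ) (hD : 0 < D) (x : ℝ) (ha : (a : ℝ) ≤ D * x)
    (hb : (D : ℝ) * x ≤ b) (f : List ℤ) (h : 0 < (ihz a b D f).1) : 0 < leval x f := by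
  have hDr : (0 : ℝ) < D := by exact_mod_cast hD
  have h1 := (ihz_sound a b D x ha hb f).1
  have hh : (0 : ℝ) < ((ihz a b D f).1 : ℝ) := by exact_mod_cast h
  by_contra hc
  push Not at hc
  have : (D : ℝ) ^ f.length * leval x f ≤ 0 := mul_nonpos_of_nonneg_of_nonpos (by positivity) hc
  linarith

/-- Interval upper bound `< 0` gives `f(x) < 0` on the interval. -/
theorem leval_neg_of_ihz (a b : ℤ) (D : ℕ) (hD : 0 < D) (x : ℝ) (ha : (a : ℝ) ≤ D * x)
    (hb : (D : ℝ) * x ≤ b) (f : List ℤ) (h : (ihz a b D f).2 < 0) : leval x f < 0 := by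
  have hDr : (0 : ℝ) < D := by exact_mod_cast hD
  have h1 := (ihz_sound a b D x ha hb f).2
  have hh : ((ihz a b D f).2 : ℝ) < 0 := by exact_mod_cast h
  by_contra hc
  push Not at hc
  have : (0 : ℝ) ≤ (D : ℝ) ^ f.length * leval x f := by positivity
  linarith

/-- Field check: `D > 0`, `a ≤ b`, `P(a/D) < 0 < P(b/D)` (scaled integer evaluations). -/
def fieldOK (P : List ℤ) (a b : ℤ) (D : ℕ) : Bool :=
  decide (0 < D) && decide (a ≤ b) && decide ((ihz a a D P).2 < 0) && decide (0 < (ihz b b D P).1)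

/-- A root of `P` in `[a/D, b/D]` exists (intermediate value theorem). -/
theorem exists_root (P : List ℤ) (a b : ℤ) (D : ℕ) (h : fieldOK P a b D = true) :
    ∃ α : ℝ, (a : ℝ) / D ≤ α ∧ α ≤ (b : ℝ) / D ∧ leval α P = 0 := by
  simp only [fieldOK, Bool.and_eq_true, decide_eq_true_eq] at h
  obtain ⟨⟨⟨hD, hab⟩, hPa⟩, hPb⟩ := h
  have hDr : (0 : ℝ) < D := by exact_mod_cast hD
  have hab' : (a : ℝ) / D ≤ (b : ℝ) / D :=
    div_le_div_of_nonneg_right (by exact_mod_cast hab) hDr.le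
  have hpt : ∀ c : ℤ, (c : ℝ) ≤ D * ((c : ℝ) / D) ∧ (D : ℝ) * ((c : ℝ) / D) ≤ c := fun c => by
    rw [mul_div_cancel₀ _ hDr.ne']; exact ⟨le_rfl, le_rfl⟩
  have hneg := leval_neg_of_ihz a a D hD _ (hpt a).1 (hpt a).2 P hPa
  have hpos := leval_pos_of_ihz b b D hD _ (hpt b).1 (hpt b).2 P hPb
  have hsub := intermediate_value_Icc hab' (continuous_leval P).continuousOn
  have h0 : (0 : ℝ) ∈ Icc (leval ((a : ℝ) / D) P) (leval ((b : ℝ) / D) P) := ⟨hneg.le, hpos.le⟩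
  obtain ⟨α, ⟨h1, h2⟩, h3⟩ := hsub h0
  exact ⟨α, h1, h2, h3⟩

/-- Weighted dot product `Σ_k W_k a_k b_k` of two rows of polynomials (truncating at the shortest list). -/
def dotL : List (List ℤ) → List (List ℤ) → List (List ℤ) → List ℤ
  | w :: W, a :: l, b :: l' => ladd (lmul w (lmul a b)) (dotL W l l')
  | _, _, _ => []

/-- The point of `ℝⁿ` attached to a row: coordinates `(√q)⁻¹ · l_k(α) · √(W_k(α))`. -/
noncomputable def avec (α : ℝ) (n : ℕ) (q : ℤ) (W : List (List ℤ)) (l : List (List ℤ)) :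
    EuclideanSpace ℝ (Fin n) :=
  toLp 2 fun i => (Real.sqrt q)⁻¹ * (leval α (l.getD i []) * Real.sqrt (leval α (W.getD i [])))

variable (α : ℝ) (n : ℕ) (q : ℤ) (W : List (List ℤ))

/-- Coordinate sums of weighted products are the evaluation of `dotL`. -/
theorem sum_getD3 (W l l' : List (List ℤ)) (hW : W.length = n) (hl : l.length = n)
    (hl' : l'.length = n) :
    ∑ i : Fin n, leval α (W.getD i []) * (leval α (l.getD i []) * leval α (l'.getD i [])) =
      leval α (dotL W l l') := by
  induction n generalizing W l l' with
  | zero =>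
    cases W with
    | nil =>
      cases l with
      | nil =>
        cases l' with
        | nil => simp [dotL]
        | cons _ _ => simp at hl'
      | cons _ _ => simp at hl
    | cons _ _ => simp at hW
  | succ m ih =>
    cases W with
    | nil => simp at hW
    | cons w Wt =>
      cases l with
      | nil => simp at hl
      | cons a t =>
        cases l' with
        | nil => simp at hl'
        | cons b t' =>
          simp only [List.length_cons, Nat.add_right_cancel_iff] at hW hl hl'
          rw [Fin.sum_univ_succ]
          simp only [Fin.val_zero, List.getD_cons_zero, Fin.val_succ, List.getD_cons_succ, dotL,
            leval_ladd, leval_lmul]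
          rw [ih Wt t t' hW hl hl']

/-- Inner products of attached points: `⟪avec l, avec l'⟫ = dotL(α) / q` (weights with `W_k(α) ≥ 0`). -/
theorem inner_avec (hq : (0 : ℝ) < q) (hW : W.length = n) (hWnn : ∀ w ∈ W, 0 ≤ leval α w)
    (l l' : List (List ℤ)) (hl : l.length = n) (hl' : l'.length = n) :
    inner ℝ (avec α n q W l) (avec α n q W l') = leval α (dotL W l l') / q := by
  have hwi : ∀ i : Fin n, 0 ≤ leval α (W.getD i []) := fun i => by
    rw [List.getD_eq_getElem _ _ (by rw [hW]; exact i.2)]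
    exact hWnn _ (List.getElem_mem _)
  rw [avec, avec, EuclideanSpace.inner_toLp_toLp, dotProduct]
  have hs : Real.sqrt (q : ℝ) ^ 2 = q := Real.sq_sqrt hq.le
  simp only [star_trivial]
  calc ∑ i : Fin n, (Real.sqrt (q : ℝ))⁻¹ * (leval α (l'.getD i []) * Real.sqrt (leval α (W.getD i [])))
        * ((Real.sqrt (q : ℝ))⁻¹ * (leval α (l.getD i []) * Real.sqrt (leval α (W.getD i []))))
      = (Real.sqrt (q : ℝ))⁻¹ ^ 2 *
          ∑ i : Fin n, leval α (W.getD i []) * (leval α (l.getD i []) * leval α (l'.getD i [])) := by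
        rw [Finset.mul_sum]
        refine Finset.sum_congr rfl fun i _ => ?_
        have hw : Real.sqrt (leval α (W.getD i [])) ^ 2 = leval α (W.getD i []) := Real.sq_sqrt (hwi i)
        linear_combination ((Real.sqrt (q : ℝ))⁻¹ ^ 2 * (leval α (l.getD i []) * leval α (l'.getD i []))) * hw
    _ = leval α (dotL W l l') / q := by
        rw [sum_getD3 α n W l l' hW hl hl', inv_pow, hs]; ring

/-- A row with `dotL(α) = q` gives a unit vector. -/
theorem norm_avec (hq : (0 : ℝ) < q) (hW : W.length = n) (hWnn : ∀ w ∈ W, 0 ≤ leval α w)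
    (l : List (List ℤ)) (hl : l.length = n) (hll : leval α (dotL W l l) = q) :
    ‖avec α n q W l‖ = 1 := by
  have h := inner_avec α n q W hq hW hWnn l l hl hl
  rw [hll, div_self hq.ne', real_inner_self_eq_norm_sq] at h
  nlinarith [norm_nonneg (avec α n q W l)]

/-- Shape: `n` weights, every row has `n` coordinates. -/
def shapeA (W : List (List ℤ)) (L : List (List (List ℤ))) (n : ℕ) : Bool :=
  (W.length == n) && L.all fun l => l.length == n

/-- Weights are nonnegative on the interval. -/
def weightsOK (a b : ℤ) (D : ℕ) (W : List (List ℤ)) : Bool :=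
  W.all fun w => decide (0 ≤ (ihz a b D w).1)

/-- The bound is `< 1` on the interval: upper bound of `Snum − sden` is negative. -/
def boundOK (a b : ℤ) (D : ℕ) (Snum : List ℤ) (sden : ℕ) : Bool :=
  decide (0 < sden) && decide ((ihz a b D (lsub Snum [(sden : ℤ)])).2 < 0)

/-- Norm certificate of a row: `c ≠ 0` and `c · (dotL l l − q) − u · P ≡ 0`. -/
def normOK (P : List ℤ) (W : List (List ℤ)) (q : ℤ) (l : List (List ℤ)) (cu : ℤ × List ℤ) : Bool :=
  (cu.1 != 0) && lzero (lsub (lsmul cu.1 (lsub (dotL W l l) [q])) (lmul cu.2 P))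

/-- Pair certificate: `c > 0` and the interval lower bound of `c · (q · Snum − sden · dotL l l') − u · P`
is nonnegative. -/
def pairOK (P : List ℤ) (a b : ℤ) (D : ℕ) (W : List (List ℤ)) (q : ℤ) (Snum : List ℤ) (sden : ℕ)
    (l l' : List (List ℤ)) (cu : ℤ × List ℤ) : Bool :=
  decide (0 < cu.1) &&
    decide (0 ≤ (ihz a b D (lsub (lsmul cu.1 (lsub (lsmul q Snum) (lsmul (sden : ℤ) (dotL W l l'))))
      (lmul cu.2 P))).1)

/-- All rows: norm certificates `NC` (aligned with `L`) and pair certificates `PC` (an `|L| × |L|` table). -/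
def rowsOK (P : List ℤ) (a b : ℤ) (D : ℕ) (W : List (List ℤ)) (q : ℤ) (Snum : List ℤ) (sden : ℕ)
    (L : List (List (List ℤ))) (NC : List (ℤ × List ℤ)) (PC : List (List (ℤ × List ℤ))) : Bool :=
  (List.range L.length).all fun i =>
    normOK P W q (L.getD i []) (NC.getD i (0, [])) &&
      (List.range L.length).all fun j =>
        (i == j) || pairOK P a b D W q Snum sden (L.getD i []) (L.getD j []) ((PC.getD i []).getD j (0, []))

variable {α n q W}

/-- Unpacking `shapeA`: weight count. -/
theorem wlength_of_shapeA {L : List (List (List ℤ))} (h : shapeA W L n = true) : W.length = n := by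
  simp only [shapeA, Bool.and_eq_true, beq_iff_eq, List.all_eq_true] at h; exact h.1

/-- Unpacking `shapeA`: row lengths. -/
theorem length_of_shapeA {L : List (List (List ℤ))} (h : shapeA W L n = true) {i : ℕ}
    (hi : i < L.length) : (L.getD i []).length = n := by
  simp only [shapeA, Bool.and_eq_true, beq_iff_eq, List.all_eq_true] at h
  rw [List.getD_eq_getElem _ _ hi]; exact h.2 _ (List.getElem_mem hi)

/-- Unpacking `weightsOK`. -/
theorem weights_nonneg {a b : ℤ} {D : ℕ} (hD : 0 < D) (ha : (a : ℝ) ≤ D * α) (hb : (D : ℝ) * α ≤ b)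
    (h : weightsOK a b D W = true) : ∀ w ∈ W, 0 ≤ leval α w := by
  simp only [weightsOK, List.all_eq_true, decide_eq_true_eq] at h
  exact fun w hw => leval_nonneg_of_ihz a b D hD α ha hb w (h w hw)

/-- Unpacking `normOK`: the row evaluates to weighted self-product `q`. -/
theorem dot_self_of_normOK {P : List ℤ} (hP : leval α P = 0) {l : List (List ℤ)} {cu : ℤ × List ℤ}
    (h : normOK P W q l cu = true) : leval α (dotL W l l) = q := by
  simp only [normOK, Bool.and_eq_true, bne_iff_ne, ne_eq] at h
  obtain ⟨hc, hz⟩ := h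
  have h0 := leval_of_lzero α hz
  simp only [leval_lsub, leval_lsmul, leval_lmul, hP, mul_zero, sub_zero, leval_cons, leval_nil,
    mul_zero, add_zero] at h0
  have hc' : (cu.1 : ℝ) ≠ 0 := by exact_mod_cast hc
  have := (mul_eq_zero.1 h0).resolve_left hc'
  linarith

/-- Unpacking `pairOK`: the pair's weighted product is at most `q · s(α)`. -/
theorem dot_le_of_pairOK {P : List ℤ} {a b : ℤ} {D : ℕ} (hD : 0 < D) (ha : (a : ℝ) ≤ D * α)
    (hb : (D : ℝ) * α ≤ b) (hP : leval α P = 0) {Snum : List ℤ} {sden : ℕ} {l l' : List (List ℤ)}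
    {cu : ℤ × List ℤ} (h : pairOK P a b D W q Snum sden l l' cu = true) :
    (sden : ℝ) * leval α (dotL W l l') ≤ q * leval α Snum := by
  simp only [pairOK, Bool.and_eq_true, decide_eq_true_eq] at h
  obtain ⟨hc, hz⟩ := h
  have h0 := leval_nonneg_of_ihz a b D hD α ha hb _ hz
  simp only [leval_lsub, leval_lsmul, leval_lmul, hP, mul_zero, sub_zero, Int.cast_natCast] at h0
  have hc' : (0 : ℝ) < (cu.1 : ℝ) := by exact_mod_cast hc
  nlinarith

/-- **Packaging.** Certificate data passing all checks give, for a root `α ∈ [a/D, b/D]` of `P`, `|L|` unit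
vectors of `ℝⁿ` with pairwise inner products `≤ Snum(α)/sden`. -/
theorem exists_code_alg {P : List ℤ} {a b : ℤ} {D : ℕ} {W : List (List ℤ)} {L : List (List (List ℤ))}
    {NC : List (ℤ × List ℤ)} {PC : List (List (ℤ × List ℤ))} {q : ℤ} {Snum : List ℤ} {sden : ℕ}
    {n : ℕ} (hF : fieldOK P a b D = true) (hq : 0 < q) (hWk : weightsOK a b D W = true)
    (hS : shapeA W L n = true) (hR : rowsOK P a b D W q Snum sden L NC PC = true)
    (hB : boundOK a b D Snum sden = true) :
    ∃ α : ℝ, (a : ℝ) / D ≤ α ∧ α ≤ (b : ℝ) / D ∧ leval α P = 0 ∧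
      ∃ C : Finset (EuclideanSpace ℝ (Fin n)), C.card = L.length ∧ (∀ x ∈ C, ‖x‖ = 1) ∧
        ∀ x ∈ C, ∀ y ∈ C, x ≠ y → inner ℝ x y ≤ leval α Snum / sden := by
  obtain ⟨α, h1, h2, hP⟩ := exists_root P a b D hF
  have hD : 0 < D := by
    simp only [fieldOK, Bool.and_eq_true, decide_eq_true_eq] at hF; exact hF.1.1.1
  have hDr : (0 : ℝ) < D := by exact_mod_cast hD
  have ha : (a : ℝ) ≤ D * α := by rw [div_le_iff₀ hDr] at h1; linarith
  have hb : (D : ℝ) * α ≤ b := by rw [le_div_iff₀ hDr] at h2; linarith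
  have hqr : (0 : ℝ) < q := by exact_mod_cast hq
  have hWnn := weights_nonneg (α := α) (W := W) hD ha hb hWk
  have hWl := wlength_of_shapeA hS
  simp only [boundOK, Bool.and_eq_true, decide_eq_true_eq] at hB
  obtain ⟨hsden, hs1⟩ := hB
  have hs1' := leval_neg_of_ihz a b D hD α ha hb _ hs1
  simp only [leval_lsub, leval_cons, leval_nil, mul_zero, add_zero, Int.cast_natCast] at hs1'
  have hsdr : (0 : ℝ) < sden := by exact_mod_cast hsden
  simp only [rowsOK, List.all_eq_true, List.mem_range, Bool.and_eq_true, Bool.or_eq_true,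
    beq_iff_eq] at hR
  set pt : ℕ → EuclideanSpace ℝ (Fin n) := fun i => avec α n q W (L.getD i []) with hpt
  have hnorm : ∀ i, i < L.length → ‖pt i‖ = 1 := fun i hi =>
    norm_avec α n q W hqr hWl hWnn _ (length_of_shapeA hS hi) (dot_self_of_normOK hP (hR i hi).1)
  have hinner : ∀ i, i < L.length → ∀ j, j < L.length → i ≠ j →
      inner ℝ (pt i) (pt j) ≤ leval α Snum / sden := by
    intro i hi j hj hij
    have hp := ((hR i hi).2 j hj).resolve_left hij
    have hle := dot_le_of_pairOK (q := q) hD ha hb hP hp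
    rw [hpt, inner_avec α n q W hqr hWl hWnn _ _ (length_of_shapeA hS hi) (length_of_shapeA hS hj),
      div_le_div_iff₀ hqr hsdr]
    linarith
  have hinj : ∀ i, i < L.length → ∀ j, j < L.length → pt i = pt j → i = j := by
    intro i hi j hj he
    by_contra hij
    have h := hinner i hi j hj hij
    rw [he, real_inner_self_eq_norm_sq, hnorm j hj, one_pow] at h
    have : leval α Snum / sden < 1 := by rw [div_lt_one hsdr]; linarith
    linarith
  refine ⟨α, h1, h2, hP, ((List.range L.length).map pt).toFinset, ?_, ?_, ?_⟩
  · rw [List.toFinset_card_of_nodup, List.length_map, List.length_range]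
    exact List.nodup_range.map_on fun i hi j hj he =>
      hinj i (List.mem_range.1 hi) j (List.mem_range.1 hj) he
  · intro x hx
    simp only [List.mem_toFinset, List.mem_map, List.mem_range] at hx
    obtain ⟨i, hi, rfl⟩ := hx
    exact hnorm i hi
  · intro x hx y hy hxy
    simp only [List.mem_toFinset, List.mem_map, List.mem_range] at hx hy
    obtain ⟨i, hi, rfl⟩ := hx; obtain ⟨j, hj, rfl⟩ := hy
    exact hinner i hi j hj (fun h => hxy (by rw [h]))
end Summit.Ventures.PackingBounds.Config.AlgWeighted
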